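import Summits.AnomalousDissipation.AnomalousDissipation.Theorems.MarginalStabilityChainStrainedLayerLawStubVorticityUniformBoundsI
import Mathlib.Analysis.Calculus.Deriv.MeanValue
import Mathlib.Topology.Order.Monotone

/-!
# Stub `stub_vorticityUniformBounds` (crux stmt-AnomalousDissipation-3007, line `strain-work-sum-rule`) — tools J:
# the Nash-type interpolation by Cauchy–Schwarz, the two-branch alternative, a barrier on `[t₀, T]`

Support file (`--supports stmt-AnomalousDissipation-3007`; registered sub-goal
`stub_vorticityUniformBounds_nashInterpolation`). Real-variable backbone of the enstrophy step (c′):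
* `stub_vorticityUniformBounds_nashInterpolation`: `(∫∫ f²)³ ≤ (∫∫ |f|)² ∫∫ f⁴` on the period strip (Cauchy–Schwarz twice:
  `(∫f²)² ≤ ∫|f| ∫|f|³`, `(∫|f|³)² ≤ ∫f² ∫f⁴`);
* `kato_nash_alternative`: `F₂³ ≤ A²(2L⁻¹F₂^{3/2}P^{1/2} + 4F₂P)` ⇒ `F₂² ≤ 8A²P ∨ L²F₂³ ≤ 16A⁴P`;
* `kato_enstrophy_rhs_neg`: under that alternative, `F₂ − 2νP < 0` once `F₂ > max(4A²/ν, 1, 8A⁴/(νL²))`;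
* `kato_barrier_Icc`: the barrier principle on a compact interval (derivative form).
All `[folklore]`.
-/

-- `Summit.<Summit>.<Problem>` is the tree's mandated summit-side namespace (CONVENTIONS §2); for this
-- single-conjunct summit the two coincide, so the duplicate is deliberate.
set_option linter.dupNamespace false

noncomputable section

open scoped Topology ENNReal
open Filter Set Function MeasureTheory

namespace Summit.AnomalousDissipation.AnomalousDissipation.Theorems.StrainedLayerLaw.StrainWorkSumRule

open Literature.Analysis.FluidPDE Literature.Analysis.FluidPDE.StretchedLayer
open Summit.AnomalousDissipation.AnomalousDissipation.Theorems.MarginalStabilityChainStretchedVortexRows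

/-! ## Nash-type lower bound for the enstrophy dissipation by Cauchy–Schwarz twice -/

section NashType

variable {L : ℝ} {f : ℝ × ℝ → ℝ}

/-- `(∫∫ f²)² ≤ (∫∫ |f|)(∫∫ |f|³)` (Cauchy–Schwarz with `√|f|` and `|f|√|f|`). [folklore] -/
theorem kato_sq_integral_sq_le (hf : Continuous f) (h1 : IntegrableOn (fun q => |f q|) (Ioc 0 L ×ˢ univ))
    (h3 : IntegrableOn (fun q => |f q| ^ 3) (Ioc 0 L ×ˢ univ)) :
    (∫ q in Ioc 0 L ×ˢ univ, f q ^ 2) ^ 2 ≤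
      (∫ q in Ioc 0 L ×ˢ univ, |f q|) * ∫ q in Ioc 0 L ×ˢ univ, |f q| ^ 3 := by
  have hφ : Continuous fun q => Real.sqrt |f q| := Real.continuous_sqrt.comp hf.abs
  have hχ : Continuous fun q => |f q| * Real.sqrt |f q| := hf.abs.mul hφ
  have e1 : ∀ q, Real.sqrt |f q| ^ 2 = |f q| := fun q => Real.sq_sqrt (abs_nonneg _)
  have e2 : ∀ q, (|f q| * Real.sqrt |f q|) ^ 2 = |f q| ^ 3 := fun q => by rw [mul_pow, e1]; ring
  have e3 : ∀ q, abs (Real.sqrt (abs (f q))) * abs (abs (f q) * Real.sqrt (abs (f q))) = f q ^ 2 := fun q => by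
    rw [abs_of_nonneg (Real.sqrt_nonneg _), abs_of_nonneg (mul_nonneg (abs_nonneg _) (Real.sqrt_nonneg _)),
      ← sq_abs (f q)]
    have h := e1 q
    calc Real.sqrt |f q| * (|f q| * Real.sqrt |f q|) = |f q| * Real.sqrt |f q| ^ 2 := by ring
      _ = |f q| ^ 2 := by rw [h]; ring
  have h1' : IntegrableOn (fun q => Real.sqrt |f q| ^ 2) (Ioc 0 L ×ˢ univ) := by simp only [e1]; exact h1
  have h3' : IntegrableOn (fun q => (|f q| * Real.sqrt |f q|) ^ 2) (Ioc 0 L ×ˢ univ) := by simp only [e2]; exact h3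
  have h := kato_strip_cauchySchwarz (L := L) (φ := fun q => Real.sqrt |f q|) (χ := fun q => |f q| * Real.sqrt |f q|)
    hφ hχ h1' h3'
  simp only [e1, e2, e3] at h
  have h0 : 0 ≤ ∫ q in Ioc 0 L ×ˢ univ, f q ^ 2 :=
    setIntegral_nonneg (measurableSet_Ioc.prod MeasurableSet.univ) fun q _ => sq_nonneg _
  calc (∫ q in Ioc 0 L ×ˢ univ, f q ^ 2) ^ 2 ≤ (Real.sqrt (∫ q in Ioc 0 L ×ˢ univ, |f q|) *
        Real.sqrt (∫ q in Ioc 0 L ×ˢ univ, |f q| ^ 3)) ^ 2 := pow_le_pow_left₀ h0 h 2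
    _ = (∫ q in Ioc 0 L ×ˢ univ, |f q|) * ∫ q in Ioc 0 L ×ˢ univ, |f q| ^ 3 := by
        rw [mul_pow, Real.sq_sqrt (setIntegral_nonneg (measurableSet_Ioc.prod MeasurableSet.univ)
          fun q _ => abs_nonneg _), Real.sq_sqrt (setIntegral_nonneg (measurableSet_Ioc.prod MeasurableSet.univ)
          fun q _ => by positivity)]

/-- `(∫∫ |f|³)² ≤ (∫∫ f²)(∫∫ f⁴)` (Cauchy–Schwarz with `f` and `f²`). [folklore] -/
theorem kato_sq_integral_cube_le (hf : Continuous f) (h2 : IntegrableOn (fun q => f q ^ 2) (Ioc 0 L ×ˢ univ))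
    (h4 : IntegrableOn (fun q => f q ^ 4) (Ioc 0 L ×ˢ univ)) :
    (∫ q in Ioc 0 L ×ˢ univ, |f q| ^ 3) ^ 2 ≤
      (∫ q in Ioc 0 L ×ˢ univ, f q ^ 2) * ∫ q in Ioc 0 L ×ˢ univ, f q ^ 4 := by
  have e2 : ∀ q, (f q ^ 2) ^ 2 = f q ^ 4 := fun q => by ring
  have e3 : ∀ q, |f q| * |f q ^ 2| = |f q| ^ 3 := fun q => by rw [abs_pow, ← pow_succ']
  have h4' : IntegrableOn (fun q => (f q ^ 2) ^ 2) (Ioc 0 L ×ˢ univ) := by simp only [e2]; exact h4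
  have h := kato_strip_cauchySchwarz (L := L) (φ := f) (χ := fun q => f q ^ 2) hf (hf.pow 2) h2 h4'
  simp only [e2, e3] at h
  have h0 : 0 ≤ ∫ q in Ioc 0 L ×ˢ univ, |f q| ^ 3 :=
    setIntegral_nonneg (measurableSet_Ioc.prod MeasurableSet.univ) fun q _ => by positivity
  calc (∫ q in Ioc 0 L ×ˢ univ, |f q| ^ 3) ^ 2 ≤ (Real.sqrt (∫ q in Ioc 0 L ×ˢ univ, f q ^ 2) *
        Real.sqrt (∫ q in Ioc 0 L ×ˢ univ, f q ^ 4)) ^ 2 := pow_le_pow_left₀ h0 h 2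
    _ = (∫ q in Ioc 0 L ×ˢ univ, f q ^ 2) * ∫ q in Ioc 0 L ×ˢ univ, f q ^ 4 := by
        rw [mul_pow, Real.sq_sqrt (setIntegral_nonneg (measurableSet_Ioc.prod MeasurableSet.univ)
          fun q _ => sq_nonneg _), Real.sq_sqrt (setIntegral_nonneg (measurableSet_Ioc.prod MeasurableSet.univ)
          fun q _ => by positivity)]

/-- **Nash-type interpolation `‖f‖₂⁶ ≤ ‖f‖₁² ‖f‖₄⁴`** on the period strip: `(∫∫ f²)³ ≤ (∫∫ |f|)² ∫∫ f⁴`. [folklore] -/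
theorem stub_vorticityUniformBounds_nashInterpolation {L : ℝ} {f : ℝ × ℝ → ℝ} (hf : Continuous f)
    (h1 : IntegrableOn (fun q => |f q|) (Ioc 0 L ×ˢ univ))
    (h2 : IntegrableOn (fun q => f q ^ 2) (Ioc 0 L ×ˢ univ))
    (h3 : IntegrableOn (fun q => |f q| ^ 3) (Ioc 0 L ×ˢ univ))
    (h4 : IntegrableOn (fun q => f q ^ 4) (Ioc 0 L ×ˢ univ)) :
    (∫ q in Ioc 0 L ×ˢ univ, f q ^ 2) ^ 3 ≤
      (∫ q in Ioc 0 L ×ˢ univ, |f q|) ^ 2 * ∫ q in Ioc 0 L ×ˢ univ, f q ^ 4 := by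
  have hA := kato_sq_integral_sq_le hf h1 h3
  have hB := kato_sq_integral_cube_le hf h2 h4
  have hS : MeasurableSet (Ioc (0:ℝ) L ×ˢ (univ : Set ℝ)) := measurableSet_Ioc.prod MeasurableSet.univ
  have hF2 : 0 ≤ ∫ q in Ioc 0 L ×ˢ univ, f q ^ 2 := setIntegral_nonneg hS fun q _ => sq_nonneg _
  have hI1 : 0 ≤ ∫ q in Ioc 0 L ×ˢ univ, |f q| := setIntegral_nonneg hS fun q _ => abs_nonneg _
  have hT3 : 0 ≤ ∫ q in Ioc 0 L ×ˢ univ, |f q| ^ 3 := setIntegral_nonneg hS fun q _ => by positivity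
  have hF4 : 0 ≤ ∫ q in Ioc 0 L ×ˢ univ, f q ^ 4 := setIntegral_nonneg hS fun q _ => by positivity
  -- `F2⁴ ≤ I1² T3² ≤ I1² F2 F4`, then cancel one `F2`
  rcases hF2.lt_or_eq with hpos | hzero
  · have h4' : (∫ q in Ioc 0 L ×ˢ univ, f q ^ 2) ^ 4 ≤
        (∫ q in Ioc 0 L ×ˢ univ, |f q|) ^ 2 * (∫ q in Ioc 0 L ×ˢ univ, f q ^ 2) * ∫ q in Ioc 0 L ×ˢ univ, f q ^ 4 := by
      calc (∫ q in Ioc 0 L ×ˢ univ, f q ^ 2) ^ 4 = ((∫ q in Ioc 0 L ×ˢ univ, f q ^ 2) ^ 2) ^ 2 := by ring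
        _ ≤ ((∫ q in Ioc 0 L ×ˢ univ, |f q|) * ∫ q in Ioc 0 L ×ˢ univ, |f q| ^ 3) ^ 2 :=
            pow_le_pow_left₀ (by positivity) hA 2
        _ = (∫ q in Ioc 0 L ×ˢ univ, |f q|) ^ 2 * (∫ q in Ioc 0 L ×ˢ univ, |f q| ^ 3) ^ 2 := by ring
        _ ≤ (∫ q in Ioc 0 L ×ˢ univ, |f q|) ^ 2 * ((∫ q in Ioc 0 L ×ˢ univ, f q ^ 2) * ∫ q in Ioc 0 L ×ˢ univ, f q ^ 4) :=
            mul_le_mul_of_nonneg_left hB (sq_nonneg _)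
        _ = _ := by ring
    have e : (∫ q in Ioc 0 L ×ˢ univ, f q ^ 2) ^ 4 = (∫ q in Ioc 0 L ×ˢ univ, f q ^ 2) ^ 3 * ∫ q in Ioc 0 L ×ˢ univ, f q ^ 2 := by ring
    rw [e] at h4'
    have h5 : (∫ q in Ioc 0 L ×ˢ univ, f q ^ 2) ^ 3 * (∫ q in Ioc 0 L ×ˢ univ, f q ^ 2) ≤
        ((∫ q in Ioc 0 L ×ˢ univ, |f q|) ^ 2 * ∫ q in Ioc 0 L ×ˢ univ, f q ^ 4) * ∫ q in Ioc 0 L ×ˢ univ, f q ^ 2 := by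
      linarith [h4']
    exact le_of_mul_le_mul_right h5 hpos
  · rw [← hzero]; simp only [ne_eq, OfNat.ofNat_ne_zero, not_false_eq_true, zero_pow]; positivity

/-- **The two-branch Nash alternative on the cylinder.** If `F₂³ ≤ A²·(2L⁻¹F₂^{3/2}P^{1/2} + 4F₂P)` with
`F₂, P ≥ 0`, `A, L > 0`, then `F₂² ≤ 8A²P` or `L²F₂³ ≤ 16A⁴P`. [folklore] -/
theorem kato_nash_alternative {F₂ P A L : ℝ} (hF : 0 ≤ F₂) (hP : 0 ≤ P) (hA : 0 < A) (hL : 0 < L)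
    (h : F₂ ^ 3 ≤ A ^ 2 * (2 * L⁻¹ * (F₂ * Real.sqrt F₂) * Real.sqrt P + 4 * F₂ * P)) :
    F₂ ^ 2 ≤ 8 * A ^ 2 * P ∨ L ^ 2 * F₂ ^ 3 ≤ 16 * A ^ 4 * P := by
  rcases hF.lt_or_eq with hpos | hzero
  swap
  · left; rw [← hzero]; simp only [ne_eq, OfNat.ofNat_ne_zero, not_false_eq_true, zero_pow]; positivity
  have hsF : Real.sqrt F₂ ^ 2 = F₂ := Real.sq_sqrt hF
  have hsP : Real.sqrt P ^ 2 = P := Real.sq_sqrt hP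
  have hsF0 : 0 < Real.sqrt F₂ := Real.sqrt_pos.2 hpos
  have hsP0 : 0 ≤ Real.sqrt P := Real.sqrt_nonneg _
  -- divide by `F₂`: `F₂² ≤ A²(2L⁻¹ √F₂ √P + 4P)`
  have h1 : F₂ ^ 2 ≤ A ^ 2 * (2 * L⁻¹ * Real.sqrt F₂ * Real.sqrt P + 4 * P) := by
    have e : A ^ 2 * (2 * L⁻¹ * (F₂ * Real.sqrt F₂) * Real.sqrt P + 4 * F₂ * P) =
        (A ^ 2 * (2 * L⁻¹ * Real.sqrt F₂ * Real.sqrt P + 4 * P)) * F₂ := by ring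
    rw [e, show F₂ ^ 3 = F₂ ^ 2 * F₂ by ring] at h
    exact le_of_mul_le_mul_right h hpos
  by_cases hcase : 2 * L⁻¹ * Real.sqrt F₂ * Real.sqrt P ≤ 4 * P
  · left
    nlinarith [h1, hcase, sq_nonneg A]
  · right
    push Not at hcase
    -- `4P < 2L⁻¹√F₂√P`, so `F₂² ≤ 4A²L⁻¹√F₂√P`; square and use `√F₂² = F₂`, `√P² = P`
    have h2 : F₂ ^ 2 ≤ A ^ 2 * (4 * L⁻¹ * Real.sqrt F₂ * Real.sqrt P) := by nlinarith [h1, hcase, sq_nonneg A]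
    have h3 : (F₂ ^ 2) ^ 2 ≤ (A ^ 2 * (4 * L⁻¹ * Real.sqrt F₂ * Real.sqrt P)) ^ 2 := pow_le_pow_left₀ (sq_nonneg _) h2 2
    have e : (A ^ 2 * (4 * L⁻¹ * Real.sqrt F₂ * Real.sqrt P)) ^ 2 = 16 * A ^ 4 * L⁻¹ ^ 2 * F₂ * P := by
      rw [show (A ^ 2 * (4 * L⁻¹ * Real.sqrt F₂ * Real.sqrt P)) ^ 2 =
        16 * A ^ 4 * L⁻¹ ^ 2 * Real.sqrt F₂ ^ 2 * Real.sqrt P ^ 2 by ring, hsF, hsP]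
    rw [e] at h3
    have h4 : L ^ 2 * F₂ ^ 4 ≤ 16 * A ^ 4 * F₂ * P := by
      have := mul_le_mul_of_nonneg_left h3 (sq_nonneg L)
      have e2 : L ^ 2 * (16 * A ^ 4 * L⁻¹ ^ 2 * F₂ * P) = 16 * A ^ 4 * F₂ * P := by field_simp
      rw [e2] at this
      calc L ^ 2 * F₂ ^ 4 = L ^ 2 * (F₂ ^ 2) ^ 2 := by ring
        _ ≤ _ := this
    have h5 : (L ^ 2 * F₂ ^ 3) * F₂ ≤ (16 * A ^ 4 * P) * F₂ := by nlinarith [h4]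
    exact le_of_mul_le_mul_right h5 hpos

/-- **The enstrophy right-hand side is negative above an explicit threshold.** With the alternative of
`kato_nash_alternative` in hand, `ν > 0`, and `F₂ > K = max(4A²/ν, max 1 (8A⁴/(νL²)))`: `F₂ − 2νP < 0`. [folklore] -/
theorem kato_enstrophy_rhs_neg {F₂ P A L ν : ℝ} (hν : 0 < ν) (hA : 0 < A) (hL : 0 < L)
    (halt : F₂ ^ 2 ≤ 8 * A ^ 2 * P ∨ L ^ 2 * F₂ ^ 3 ≤ 16 * A ^ 4 * P)
    (hK : max (4 * A ^ 2 / ν) (max 1 (8 * A ^ 4 / (ν * L ^ 2))) < F₂) : F₂ - 2 * ν * P < 0 := by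
  have hK1 : 4 * A ^ 2 / ν < F₂ := lt_of_le_of_lt (le_max_left _ _) hK
  have hK2 : 1 < F₂ := lt_of_le_of_lt ((le_max_left _ _).trans (le_max_right _ _)) hK
  have hK3 : 8 * A ^ 4 / (ν * L ^ 2) < F₂ := lt_of_le_of_lt ((le_max_right _ _).trans (le_max_right _ _)) hK
  have hF : 0 < F₂ := lt_trans one_pos hK2
  rcases halt with h | h
  · -- `P ≥ F₂²/(8A²)` and `F₂ > 4A²/ν`
    rw [div_lt_iff₀ hν] at hK1
    have h1 := mul_le_mul_of_nonneg_left h hν.le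
    have h2 := mul_lt_mul_of_pos_left hK1 hF
    nlinarith [h1, h2, sq_pos_of_pos hA]
  · -- `P ≥ L²F₂³/(16A⁴)` and `F₂² > 8A⁴/(νL²)`
    rw [div_lt_iff₀ (by positivity)] at hK3
    have hF2 : 8 * A ^ 4 < F₂ ^ 2 * (ν * L ^ 2) := by
      have hpos : 0 < F₂ * (ν * L ^ 2) * (F₂ - 1) := mul_pos (mul_pos hF (by positivity)) (sub_pos.2 hK2)
      nlinarith [hK3, hpos]
    have h1 := mul_le_mul_of_nonneg_left h hν.le
    have h2 := mul_lt_mul_of_pos_left hF2 hF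
    nlinarith [h1, h2, pow_pos hA 4]

end NashType

/-! ## A barrier principle on a compact time interval -/

section BarrierIcc

/-- **Barrier principle on `[t₀, T]`, derivative form.** If `f` is continuous on `[t₀, T]` and at every
`s ∈ (t₀, T]` with `f s > K` it has a derivative `D < 0`, then `f t ≤ max (f t₀) K` on `[t₀, T]`
(cf. `stub_vorticityUniformBounds_barrier_of_hasDerivAt`, the unbounded-interval version). [folklore] -/
theorem kato_barrier_Icc {f : ℝ → ℝ} {t₀ T K t : ℝ} (hcont : ContinuousOn f (Icc t₀ T))
    (hderiv : ∀ s ∈ Ioc t₀ T, K < f s → ∃ D : ℝ, HasDerivAt f D s ∧ D < 0) (ht : t ∈ Icc t₀ T) :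
    f t ≤ max (f t₀) K := by
  by_contra hlt
  push Not at hlt
  set K' : ℝ := max (f t₀) K with hK'
  set S : Set ℝ := Icc t₀ t ∩ f ⁻¹' Iic K' with hS
  have hsub : Icc t₀ t ⊆ Icc t₀ T := Icc_subset_Icc_right ht.2
  have hSclosed : IsClosed S := (hcont.mono hsub).preimage_isClosed_of_isClosed isClosed_Icc isClosed_Iic
  have ht₀S : t₀ ∈ S := ⟨left_mem_Icc.2 ht.1, show f t₀ ≤ K' from le_max_left _ _⟩
  have hSbdd : BddAbove S := ⟨t, fun s hs => hs.1.2⟩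
  set c : ℝ := sSup S with hc
  have hcS : c ∈ S := hSclosed.csSup_mem ⟨t₀, ht₀S⟩ hSbdd
  have hfc : f c ≤ K' := hcS.2
  have hct : c < t := by
    rcases lt_or_eq_of_le hcS.1.2 with h | h
    · exact h
    · exact absurd (h ▸ hfc) (not_le.2 hlt)
  have habove : ∀ s ∈ Ioc c t, K' < f s := by
    intro s hs
    by_contra hle
    push Not at hle
    have hsS : s ∈ S := ⟨⟨hcS.1.1.trans hs.1.le, hs.2⟩, show f s ≤ K' from hle⟩
    exact (not_le.2 hs.1) (le_csSup hSbdd hsS)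
  -- mean value theorem on `[c, t]`
  choose! D hD using hderiv
  have hcont' : ContinuousOn f (Icc c t) := hcont.mono fun r hr => ⟨hcS.1.1.trans hr.1, hr.2.trans ht.2⟩
  have hmem : ∀ r ∈ Ioc c t, r ∈ Ioc t₀ T := fun r hr => ⟨lt_of_le_of_lt hcS.1.1 hr.1, hr.2.trans ht.2⟩
  have hdiff : ∀ r ∈ Ioo c t, HasDerivAt f (D r) r := fun r hr =>
    (hD r (hmem r (Ioo_subset_Ioc_self hr)) ((le_max_right _ _).trans_lt (habove r (Ioo_subset_Ioc_self hr)))).1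
  obtain ⟨ξ, hξ, hslope⟩ := exists_hasDerivAt_eq_slope f D hct hcont' hdiff
  have hneg : D ξ < 0 :=
    (hD ξ (hmem ξ (Ioo_subset_Ioc_self hξ)) ((le_max_right _ _).trans_lt (habove ξ (Ioo_subset_Ioc_self hξ)))).2
  have hpos : 0 < (f t - f c) / (t - c) := div_pos (by linarith [habove t ⟨hct, le_rfl⟩]) (sub_pos.2 hct)
  rw [hslope] at hneg
  linarith

end BarrierIcc


end Summit.AnomalousDissipation.AnomalousDissipation.Theorems.StrainedLayerLaw.StrainWorkSumRule

end
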